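import Literature.Analysis.Complex.MellinBarnesShift
import Literature.Analysis.Complex.PeriodicEntireFourier
import Mathlib.Analysis.Complex.LocallyUniformLimit
import Mathlib.Analysis.SpecialFunctions.Exp
import HarnessLib

/-!
# Superexponential decay of the coefficients of a Dirichlet series that continues to an entire
# function of finite order and of "degree `< 1`" growth on far-left vertical lines

Topic `Literature/Analysis/Complex`, continuing `CahenMellinDirichlet.lean`, `MellinBarnesShift.lean`
and `PeriodicEntireFourier.lean`. Everything here is PROVED; no named facts, no definitions.

**The engine** (`norm_coeff_le_exp_of_leftBound`). Let `Φ` be entire, equal to an absolutely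
convergent Dirichlet series `∑ b(n) n^{−s}` on the line `re s = 3/2`, of finite order
`‖Φ(s)‖ ≤ C_k e^{‖s‖^B}` in every strip `−k − 1/2 ≤ re s ≤ 3/2`, and suppose that on the lines
`re s = σ_k = −k − 1/2`, uniformly in `k ≥ k₀`,

  `‖Φ(σ_k + it)‖ ≤ C₀ C₁^k (k + M + |t|)^{d(k+1) + E₀}`   with   `d < 1`.

Then for every real `X` there is `M_X` with `‖b(n)‖ ≤ M_X e^{−nX}` for all `n ≥ 1`: the
coefficients decay faster than any exponential, so that `∑ b(n) n^{−s}` converges absolutely on all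
of `ℂ`. (For an `L`-function with functional equation of degree `d` the left-hand bound holds by
Stirling's formula, and `d < 1` is exactly the range excluded by Richert, Bochner and Conrey–Ghosh;
the number-theoretic consequences are drawn in
`Literature/NumberTheory/LFunctions/SelbergClassDegreeProofs.lean`.)

## The argument

1. (`CahenMellinDirichlet`) `L(w) := ∑ b(n)e^{−nw} = (1/2π)∫ Φ Γ w^{−s} |_{re s = 3/2}` for `w > 0`.
2. (`MellinBarnesShift`) Shifting to `re s = σ_k`: `L(w) = ∑_{j ≤ k} c_j w^j + R_k(w)`,
   `c_j = (−1)^j Φ(−j)/j!`, `R_k(w) = (1/2π)∫ Φ Γ w^{−s} |_{re s = σ_k}`.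
3. (`norm_remainder_le`, the key estimate) With `q_k = ⌊(1−d)(k+1)/2⌋` and
   `∏_{j≤k} √((j+1/2)² + t²) ≥ q_k! (q_k + |t|)^{k+1−q_k}/2^{k+1}` one gets, uniformly in `t`,
   `‖Φ(σ_k+it) Γ(σ_k+it)‖ ≤ C₀C₁^k (2C₆)^{k+1} √(2π) e^{−π|t|/2} / q_k!`; here `d < 1` is used
   (`d(k+1) + E₀ ≤ k + 1 − q_k`). Hence `R_k(w) → 0` as `k → ∞`, for every fixed `w > 0`.
4. So `∑_j c_j w^j` converges to `L(w)` for every `w > 0`; the power series `Ẽ(z) = ∑ c_j z^j`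
   has infinite radius, `Ẽ` is entire, and `Ẽ = L` on the right half-plane (identity theorem).
5. `L(w + 2πi) = L(w)`, so `Ẽ` is `2πi`-periodic; `PeriodicEntireFourier` gives the decay.

## References

* E. C. Titchmarsh, *The Theory of the Riemann Zeta-Function*, 2nd ed. (1986), §2.7 (the model
  case `1/(e^w − 1) = 1/w + ∑ ζ(−j)(−w)^j/j!`).
* J. B. Conrey, A. Ghosh, *On the Selberg class of Dirichlet series: small degrees*, Duke Math. J.
  72 (1993), 673–693 (the Dirichlet series of an element of the Selberg class of degree `< 1`
  converges absolutely on `ℂ`; there via Perron's formula). [folklore]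
-/

noncomputable section

open _root_.Complex Set MeasureTheory Filter intervalIntegral Real
open scoped _root_.Topology

namespace Literature.Analysis.Complex

open Literature.Analysis.SpecialFunctions

/-! ### Step 3: the key estimate on the line `re s = −k − 1/2` -/

/-- **The key estimate.** Suppose `0 ≤ d < 1`, `1 ≤ M`, and let `k` be so large that
`q = ⌊(1−d)(k+1)/2⌋ ≥ 1` and `d(k+1) + E₀ ≤ k + 1 − q` (with `d(k+1) + E₀ ≥ 0`). Then for all
real `t`, with `C₆ = 2(2/(1−d) + M)`,
`(k + M + |t|)^{d(k+1)+E₀} / ∏_{j ≤ k} √((j+1/2)² + t²) ≤ (2C₆)^{k+1}/q!`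
(the polynomial growth of degree `d(k+1)+E₀ < k+1` on the left line is beaten by the `k + 1`
linear factors of `1/Γ(−k−1/2+it)`; this is where `d < 1` enters). [folklore] -/
theorem rpow_div_prod_sqrt_le {d E₀ M : ℝ} (hd1 : d < 1) (hd0 : 0 ≤ d) (hM : 1 ≤ M) {k q : ℕ}
    (hq : q = ⌊(1 - d) * (k + 1) / 2⌋₊) (hq1 : 1 ≤ q)
    (hE : d * (k + 1) + E₀ ≤ (k + 1 - q : ℕ)) (hE0 : 0 ≤ d * (k + 1) + E₀) (t : ℝ) :
    ((k : ℝ) + M + |t|) ^ (d * (k + 1) + E₀) /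
        ∏ j ∈ Finset.range (k + 1), Real.sqrt ((j + 1 / 2) ^ 2 + t ^ 2) ≤
      (2 * (2 * (2 / (1 - d) + M))) ^ (k + 1) / q.factorial := by
  obtain ⟨C₆, hC₆⟩ : ∃ C : ℝ, 2 * (2 / (1 - d) + M) = C := ⟨_, rfl⟩
  rw [hC₆]
  have h1d : 0 < 1 - d := by linarith
  have hD : 0 < 2 / (1 - d) := by positivity
  have hDM : 1 ≤ 2 / (1 - d) + M := by linarith
  have hC₆1 : 1 ≤ C₆ := by rw [← hC₆]; nlinarith
  have ht : 0 ≤ |t| := abs_nonneg t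
  have hq0 : (1 : ℝ) ≤ q := by exact_mod_cast hq1
  -- `q ≤ (1-d)(k+1)/2 < q + 1`
  have hqle : (q : ℝ) ≤ (1 - d) * (k + 1) / 2 := by
    rw [hq]; exact Nat.floor_le (by positivity)
  have hqlt : (1 - d) * (k + 1) / 2 < q + 1 := by rw [hq]; exact Nat.lt_floor_add_one _
  have hk0 : (0 : ℝ) ≤ k := k.cast_nonneg
  have hqk : q ≤ k + 1 := by
    have h1 : (1 - d) * (k + 1) / 2 ≤ k + 1 := by
      rw [div_le_iff₀ (by norm_num : (0:ℝ) < 2)]; nlinarith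
    have : (q : ℝ) ≤ k + 1 := hqle.trans h1
    exact_mod_cast this
  -- `k + 1 ≤ (2/(1-d))(q+1)`, hence `k + M + |t| ≤ C₆ (q + |t|)`
  have hk1 : (k : ℝ) + 1 ≤ 2 / (1 - d) * (q + 1) := by
    rw [div_mul_eq_mul_div, le_div_iff₀ h1d]; nlinarith
  have hβ : (k : ℝ) + M + |t| ≤ C₆ * (q + |t|) := by
    have h1 : (k : ℝ) + M ≤ (2 / (1 - d) + M) * (q + 1) := by nlinarith
    have h2 : |t| ≤ (2 / (1 - d) + M) * |t| := le_mul_of_one_le_left ht hDM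
    have h3 : (q : ℝ) + 1 + |t| ≤ 2 * (q + |t|) := by linarith
    calc (k : ℝ) + M + |t| ≤ (2 / (1 - d) + M) * (q + 1) + (2 / (1 - d) + M) * |t| := by linarith
      _ = (2 / (1 - d) + M) * (q + 1 + |t|) := by ring
      _ ≤ (2 / (1 - d) + M) * (2 * (q + |t|)) := by gcongr
      _ = C₆ * (q + |t|) := by rw [← hC₆]; ring
  have hqt : (1 : ℝ) ≤ q + |t| := by linarith
  -- numerator
  have hEk : d * (k + 1) + E₀ ≤ ((k + 1 : ℕ) : ℝ) := hE.trans (by exact_mod_cast Nat.sub_le _ _)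
  have hnum : ((k : ℝ) + M + |t|) ^ (d * (k + 1) + E₀) ≤ C₆ ^ (k + 1) * (q + |t|) ^ (k + 1 - q) := by
    calc ((k : ℝ) + M + |t|) ^ (d * (k + 1) + E₀) ≤ (C₆ * (q + |t|)) ^ (d * (k + 1) + E₀) :=
          Real.rpow_le_rpow (by positivity) hβ hE0
      _ = C₆ ^ (d * (k + 1) + E₀) * (q + |t|) ^ (d * (k + 1) + E₀) :=
          Real.mul_rpow (by positivity) (by positivity)
      _ ≤ C₆ ^ ((k + 1 : ℕ) : ℝ) * (q + |t|) ^ ((k + 1 - q : ℕ) : ℝ) :=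
          mul_le_mul (Real.rpow_le_rpow_of_exponent_le hC₆1 hEk)
            (Real.rpow_le_rpow_of_exponent_le hqt hE) (by positivity) (by positivity)
      _ = C₆ ^ (k + 1) * (q + |t|) ^ (k + 1 - q) := by rw [Real.rpow_natCast, Real.rpow_natCast]
  -- denominator
  have hden := factorial_mul_pow_le_prod_sqrt hqk t
  have hP : 0 < ∏ j ∈ Finset.range (k + 1), Real.sqrt ((j + 1 / 2) ^ 2 + t ^ 2) :=
    Finset.prod_pos fun j _ ↦ Real.sqrt_pos.2 (by positivity)
  have hqf : (0 : ℝ) < q.factorial := by positivity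
  have h2 : (0 : ℝ) < 2 ^ (k + 1) := by positivity
  rw [div_le_div_iff₀ hP hqf]
  calc ((k : ℝ) + M + |t|) ^ (d * (k + 1) + E₀) * q.factorial
      ≤ C₆ ^ (k + 1) * (q + |t|) ^ (k + 1 - q) * q.factorial := by gcongr
    _ = (2 * C₆) ^ (k + 1) * ((q.factorial : ℝ) * (q + |t|) ^ (k + 1 - q) / 2 ^ (k + 1)) := by
        rw [mul_pow, mul_div_assoc']
        field_simp
    _ ≤ (2 * C₆) ^ (k + 1) * ∏ j ∈ Finset.range (k + 1), Real.sqrt ((j + 1 / 2) ^ 2 + t ^ 2) := by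
        gcongr

/-- The key estimate in integrated form: under the hypotheses of `rpow_div_prod_sqrt_le`, if
`‖Φ(σ_k + it)‖ ≤ C₀ C₁^k (k + M + |t|)^{d(k+1)+E₀}` on the line `re s = σ_k = −k − 1/2`, then for
`w > 0`
`‖∫ Φ(σ_k+iy) w^{−(σ_k+iy)} Γ(σ_k+iy) dy‖ ≤ C₀ C₁^k √(2π) (2C₆)^{k+1}/q! · w^{k+1/2} · ∫ e^{−π|y|/2} dy`.
[folklore] -/
theorem norm_remainder_le {Φ : ℂ → ℂ} {d E₀ M C₀ C₁ : ℝ} (hd1 : d < 1) (hd0 : 0 ≤ d) (hM : 1 ≤ M)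
    (hC₀ : 0 < C₀) (hC₁ : 1 ≤ C₁) {k q : ℕ} (hq : q = ⌊(1 - d) * (k + 1) / 2⌋₊) (hq1 : 1 ≤ q)
    (hE : d * (k + 1) + E₀ ≤ (k + 1 - q : ℕ)) (hE0 : 0 ≤ d * (k + 1) + E₀)
    (hleft : ∀ t : ℝ, ‖Φ (((-(k : ℝ) - 1 / 2 : ℝ) : ℂ) + t * I)‖ ≤
      C₀ * C₁ ^ k * ((k : ℝ) + M + |t|) ^ (d * (k + 1) + E₀))
    {w : ℝ} (hw : 0 < w)
    (hint : Integrable fun y : ℝ ↦ Φ (((-(k : ℝ) - 1 / 2 : ℝ) : ℂ) + y * I) *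
        ((w : ℂ) ^ (-((((-(k : ℝ) - 1 / 2 : ℝ) : ℂ) + y * I))) *
          Complex.Gamma (((-(k : ℝ) - 1 / 2 : ℝ) : ℂ) + y * I))) :
    ‖∫ y : ℝ, Φ (((-(k : ℝ) - 1 / 2 : ℝ) : ℂ) + y * I) *
        ((w : ℂ) ^ (-((((-(k : ℝ) - 1 / 2 : ℝ) : ℂ) + y * I))) *
          Complex.Gamma (((-(k : ℝ) - 1 / 2 : ℝ) : ℂ) + y * I))‖ ≤
      C₀ * C₁ ^ k * Real.sqrt (2 * π) * ((2 * (2 * (2 / (1 - d) + M))) ^ (k + 1) / q.factorial) *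
        w ^ ((k : ℝ) + 1 / 2) * ∫ y : ℝ, Real.exp (-(π / 2 * |y|)) := by
  obtain ⟨Kq, hKq⟩ : ∃ K : ℝ, (2 * (2 * (2 / (1 - d) + M))) ^ (k + 1) / q.factorial = K := ⟨_, rfl⟩
  have hKq0 : 0 ≤ Kq := by
    rw [← hKq]; have : 0 < 1 - d := by linarith
    positivity
  have hpi : 0 < π / 2 := by positivity
  have hexpint := integrable_exp_neg_mul_abs hpi
  -- pointwise bound
  have hpt : ∀ y : ℝ, ‖Φ (((-(k : ℝ) - 1 / 2 : ℝ) : ℂ) + y * I) *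
      ((w : ℂ) ^ (-((((-(k : ℝ) - 1 / 2 : ℝ) : ℂ) + y * I))) *
        Complex.Gamma (((-(k : ℝ) - 1 / 2 : ℝ) : ℂ) + y * I))‖ ≤
      C₀ * C₁ ^ k * Real.sqrt (2 * π) * Kq * w ^ ((k : ℝ) + 1 / 2) * Real.exp (-(π / 2 * |y|)) := by
    intro y
    have hP : 0 < ∏ j ∈ Finset.range (k + 1), Real.sqrt ((j + 1 / 2) ^ 2 + y ^ 2) :=
      Finset.prod_pos fun j _ ↦ Real.sqrt_pos.2 (by positivity)
    have hΓ := norm_Gamma_neg_half_sub_nat_le k y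
    have hkey := rpow_div_prod_sqrt_le (E₀ := E₀) hd1 hd0 hM hq hq1 hE hE0 y
    rw [hKq] at hkey
    rw [norm_mul, norm_mul, Complex.norm_cpow_eq_rpow_re_of_pos hw]
    have hre : (-((((-(k : ℝ) - 1 / 2 : ℝ) : ℂ) + y * I))).re = (k : ℝ) + 1 / 2 := by
      simp; ring
    rw [hre]
    have he : Real.exp (-(π * |y|) / 2) = Real.exp (-(π / 2 * |y|)) := by congr 1; ring
    calc ‖Φ (((-(k : ℝ) - 1 / 2 : ℝ) : ℂ) + y * I)‖ * (w ^ ((k : ℝ) + 1 / 2) *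
          ‖Complex.Gamma (((-(k : ℝ) - 1 / 2 : ℝ) : ℂ) + y * I)‖)
        ≤ (C₀ * C₁ ^ k * ((k : ℝ) + M + |y|) ^ (d * (k + 1) + E₀)) * (w ^ ((k : ℝ) + 1 / 2) *
            (Real.sqrt (2 * π) * Real.exp (-(π * |y|) / 2) /
              ∏ j ∈ Finset.range (k + 1), Real.sqrt ((j + 1 / 2) ^ 2 + y ^ 2))) := by
          gcongr
          · exact hleft y
      _ = C₀ * C₁ ^ k * Real.sqrt (2 * π) * (((k : ℝ) + M + |y|) ^ (d * (k + 1) + E₀) /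
              ∏ j ∈ Finset.range (k + 1), Real.sqrt ((j + 1 / 2) ^ 2 + y ^ 2)) *
            w ^ ((k : ℝ) + 1 / 2) * Real.exp (-(π / 2 * |y|)) := by
          rw [he]; field_simp
      _ ≤ C₀ * C₁ ^ k * Real.sqrt (2 * π) * Kq * w ^ ((k : ℝ) + 1 / 2) *
            Real.exp (-(π / 2 * |y|)) := by gcongr
  calc ‖∫ y : ℝ, Φ (((-(k : ℝ) - 1 / 2 : ℝ) : ℂ) + y * I) *
        ((w : ℂ) ^ (-((((-(k : ℝ) - 1 / 2 : ℝ) : ℂ) + y * I))) *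
          Complex.Gamma (((-(k : ℝ) - 1 / 2 : ℝ) : ℂ) + y * I))‖
      ≤ ∫ y : ℝ, ‖Φ (((-(k : ℝ) - 1 / 2 : ℝ) : ℂ) + y * I) *
        ((w : ℂ) ^ (-((((-(k : ℝ) - 1 / 2 : ℝ) : ℂ) + y * I))) *
          Complex.Gamma (((-(k : ℝ) - 1 / 2 : ℝ) : ℂ) + y * I))‖ := norm_integral_le_integral_norm _
    _ ≤ ∫ y : ℝ, C₀ * C₁ ^ k * Real.sqrt (2 * π) * Kq * w ^ ((k : ℝ) + 1 / 2) *
          Real.exp (-(π / 2 * |y|)) :=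
        integral_mono hint.norm (hexpint.const_mul _) hpt
    _ = _ := by rw [MeasureTheory.integral_const_mul, hKq]

/-! ### Largeness conditions on `k` -/

/-- For `k ≥ ⌈(2 + 2E₀)/(1−d)⌉₊` (`0 ≤ d < 1`, `E₀ ≥ 0`): with `q = ⌊(1−d)(k+1)/2⌋` one has `q ≥ 1`,
`q ≤ k + 1` and `d(k+1) + E₀ ≤ k + 1 − q`. [folklore] -/
theorem floor_conditions {d E₀ : ℝ} (hd1 : d < 1) (hd0 : 0 ≤ d) (hE₀ : 0 ≤ E₀) {k : ℕ}
    (hk : ⌈(2 + 2 * E₀) / (1 - d)⌉₊ ≤ k) :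
    1 ≤ ⌊(1 - d) * (k + 1) / 2⌋₊ ∧ ⌊(1 - d) * (k + 1) / 2⌋₊ ≤ k + 1 ∧
      d * (k + 1) + E₀ ≤ ((k + 1 - ⌊(1 - d) * (k + 1) / 2⌋₊ : ℕ) : ℝ) := by
  obtain ⟨q, hq⟩ : ∃ q : ℕ, ⌊(1 - d) * (k + 1) / 2⌋₊ = q := ⟨_, rfl⟩
  rw [hq]
  have h1d : 0 < 1 - d := by linarith
  have hk' : (2 + 2 * E₀) / (1 - d) ≤ k := (Nat.le_ceil _).trans (by exact_mod_cast hk)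
  rw [div_le_iff₀ h1d] at hk'
  have hk0 : (0 : ℝ) ≤ k := k.cast_nonneg
  have hqle : (q : ℝ) ≤ (1 - d) * (k + 1) / 2 := by rw [← hq]; exact Nat.floor_le (by positivity)
  have hq1 : 1 ≤ q := by
    rw [← hq]; refine Nat.le_floor ?_; push_cast
    rw [le_div_iff₀ (by norm_num : (0:ℝ) < 2)]; nlinarith
  have hqk : q ≤ k + 1 := by
    have h1 : (1 - d) * (k + 1) / 2 ≤ k + 1 := by
      rw [div_le_iff₀ (by norm_num : (0:ℝ) < 2)]; nlinarith
    have : (q : ℝ) ≤ k + 1 := hqle.trans h1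
    exact_mod_cast this
  refine ⟨hq1, hqk, ?_⟩
  rw [Nat.cast_sub hqk]; push_cast
  have : (1 - d) * (k + 1) / 2 * 2 = (1 - d) * (k + 1) := by ring
  nlinarith

/-- `k + 1 ≤ ⌈2/(1−d)⌉₊ · (q + 1)` for `q = ⌊(1−d)(k+1)/2⌋`, `d < 1`. [folklore] -/
theorem succ_le_ceil_mul_floor_succ {d : ℝ} (hd1 : d < 1) (k : ℕ) :
    k + 1 ≤ ⌈2 / (1 - d)⌉₊ * (⌊(1 - d) * (k + 1) / 2⌋₊ + 1) := by
  obtain ⟨q, hq⟩ : ∃ q : ℕ, ⌊(1 - d) * (k + 1) / 2⌋₊ = q := ⟨_, rfl⟩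
  rw [hq]
  have h1d : 0 < 1 - d := by linarith
  have hqlt : (1 - d) * (k + 1) / 2 < q + 1 := by rw [← hq]; exact Nat.lt_floor_add_one _
  have hL : 2 / (1 - d) ≤ ⌈2 / (1 - d)⌉₊ := Nat.le_ceil _
  have hq0 : (0 : ℝ) ≤ q := q.cast_nonneg
  have hreal : (k : ℝ) + 1 ≤ ⌈2 / (1 - d)⌉₊ * (q + 1) := by
    have h1 : (k : ℝ) + 1 < 2 / (1 - d) * (q + 1) := by
      rw [div_mul_eq_mul_div, lt_div_iff₀ h1d]; nlinarith
    have h2 : 2 / (1 - d) * ((q : ℝ) + 1) ≤ ⌈2 / (1 - d)⌉₊ * (q + 1) := by gcongr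
    linarith
  exact_mod_cast hreal

/-! ### The engine -/

/-- **Superexponential decay of the coefficients.** Let `Φ` be entire, equal on the line
`re s = 3/2` to the absolutely convergent Dirichlet series `∑ b(n) n^{−s}`, of finite order
`‖Φ(s)‖ ≤ C_k e^{‖s‖^B}` in every strip `−k − 1/2 ≤ re s ≤ 3/2`, and with
`‖Φ(−k − 1/2 + it)‖ ≤ C₀ C₁^k (k + M + |t|)^{d(k+1)+E₀}` for all `k ≥ k₀`, where `0 ≤ d < 1`. Then
for every real `X` there is `M_X` with `‖b(n)‖ ≤ M_X e^{−nX}` for all `n ≥ 1`. See the module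
docstring for the argument (Cahen–Mellin, shift to `re s = −k−1/2`, `k → ∞`, periodicity).
[folklore] -/
theorem norm_coeff_le_exp_of_leftBound {Φ : ℂ → ℂ} (hΦ : Differentiable ℂ Φ) {b : ℕ → ℂ}
    (hb : LSeriesSummable b ((3 / 2 : ℝ) : ℂ))
    (hΦb : ∀ y : ℝ, Φ (((3 / 2 : ℝ) : ℂ) + y * I) = LSeries b (((3 / 2 : ℝ) : ℂ) + y * I))
    (hfin : ∃ B : ℝ, 0 < B ∧ ∀ k : ℕ, ∃ C : ℝ, ∀ s : ℂ, -(k : ℝ) - 1 / 2 ≤ s.re → s.re ≤ 3 / 2 →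
      ‖Φ s‖ ≤ C * Real.exp (‖s‖ ^ B))
    (hleft : ∃ (d E₀ C₀ C₁ M : ℝ) (k₀ : ℕ), d < 1 ∧ 0 ≤ d ∧ 0 ≤ E₀ ∧ 0 < C₀ ∧ 1 ≤ C₁ ∧ 1 ≤ M ∧
      ∀ k : ℕ, k₀ ≤ k → ∀ t : ℝ, ‖Φ (((-(k : ℝ) - 1 / 2 : ℝ) : ℂ) + t * I)‖ ≤
        C₀ * C₁ ^ k * ((k : ℝ) + M + |t|) ^ (d * (k + 1) + E₀))
    (X : ℝ) : ∃ Mx : ℝ, ∀ n : ℕ, n ≠ 0 → ‖b n‖ ≤ Mx * Real.exp (-(n * X)) := by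
  obtain ⟨B, hB, hfinC⟩ := hfin
  obtain ⟨d, E₀, C₀, C₁, M, k₀, hd1, hd0, hE₀, hC₀, hC₁, hM, hleftk⟩ := hleft
  have h1d : 0 < 1 - d := by linarith
  have hc0 : (0 : ℝ) < 3 / 2 := by norm_num
  have hc2 : (3 / 2 : ℝ) ≤ 2 := by norm_num
  -- the modified coefficients
  set b' : ℕ → ℂ := fun n ↦ if n = 0 then 0 else b n with hb'
  have hb'n : ∀ {n : ℕ}, n ≠ 0 → b' n = b n := fun hn ↦ by simp [hb', hn]
  have hb'term : ∀ (n : ℕ) (x : ℂ), b' n * x = if n = 0 then 0 else b n * x := by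
    intro n x; rcases eq_or_ne n 0 with rfl | hn
    · simp [hb']
    · simp [hb', hn]
  ------------------------------------------------------------------
  -- (0) the bound on the right line
  ------------------------------------------------------------------
  have hnormsum : Summable fun n ↦ ‖LSeries.term b ((3 / 2 : ℝ) : ℂ) n‖ := summable_norm_iff.2 hb
  obtain ⟨A₂, hA₂⟩ : ∃ A : ℝ, (∑' n : ℕ, ‖LSeries.term b ((3 / 2 : ℝ) : ℂ) n‖) + 1 = A := ⟨_, rfl⟩
  have hA₂pos : 0 < A₂ := by
    have : 0 ≤ ∑' n : ℕ, ‖LSeries.term b ((3 / 2 : ℝ) : ℂ) n‖ := tsum_nonneg fun n ↦ norm_nonneg _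
    rw [← hA₂]; linarith
  have hright : ∀ t : ℝ, ‖Φ (((3 / 2 : ℝ) : ℂ) + t * I)‖ ≤ A₂ := by
    intro t
    rw [hΦb t, LSeries]
    have heq : ∀ n, ‖LSeries.term b (((3 / 2 : ℝ) : ℂ) + t * I) n‖ =
        ‖LSeries.term b ((3 / 2 : ℝ) : ℂ) n‖ := by
      intro n
      simp only [LSeries.norm_term_eq, add_re, ofReal_re, mul_re, I_re, mul_zero, ofReal_im, I_im,
        mul_one, sub_self, add_zero]
    calc ‖∑' n, LSeries.term b (((3 / 2 : ℝ) : ℂ) + t * I) n‖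
        ≤ ∑' n, ‖LSeries.term b (((3 / 2 : ℝ) : ℂ) + t * I) n‖ :=
          norm_tsum_le_tsum_norm (by simp_rw [heq]; exact hnormsum)
      _ = ∑' n, ‖LSeries.term b ((3 / 2 : ℝ) : ℂ) n‖ := tsum_congr heq
      _ ≤ A₂ := by rw [← hA₂]; linarith
  ------------------------------------------------------------------
  -- (1) Cahen–Mellin on the right line: `Lw w = (1/2π) ∫_{3/2}`
  ------------------------------------------------------------------
  set Lw : ℝ → ℂ := fun w ↦ ∑' n : ℕ, (if n = 0 then 0 else b n * (Real.exp (-(n * w)) : ℂ))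
    with hLw
  have hCM : ∀ w : ℝ, 0 < w → Lw w =
      (1 / (2 * π) : ℂ) * ∫ y : ℝ, Φ (((3 / 2 : ℝ) : ℂ) + y * I) *
        ((w : ℂ) ^ (-(((3 / 2 : ℝ) : ℂ) + y * I)) * Complex.Gamma (((3 / 2 : ℝ) : ℂ) + y * I)) := by
    intro w hw
    rw [hLw]; dsimp only
    rw [tsum_mul_exp_neg_eq_integral_LSeries b hc0 hc2 hb hw]
    congr 1
    refine integral_congr_ae (Eventually.of_forall fun y ↦ ?_)
    simp only [hΦb y]
  ------------------------------------------------------------------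
  -- (2) the shift, for `k ≥ k₀`
  ------------------------------------------------------------------
  have hshift : ∀ w : ℝ, 0 < w → ∀ k : ℕ, k₀ ≤ k →
      (Integrable fun y : ℝ ↦ Φ (((-(k : ℝ) - 1 / 2 : ℝ) : ℂ) + y * I) *
        ((w : ℂ) ^ (-((((-(k : ℝ) - 1 / 2 : ℝ) : ℂ) + y * I))) *
          Complex.Gamma (((-(k : ℝ) - 1 / 2 : ℝ) : ℂ) + y * I))) ∧
      (1 / (2 * π) : ℂ) * (∫ y : ℝ, Φ (((3 / 2 : ℝ) : ℂ) + y * I) *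
        ((w : ℂ) ^ (-((((3 / 2 : ℝ) : ℂ) + y * I))) * Complex.Gamma (((3 / 2 : ℝ) : ℂ) + y * I))) -
      (1 / (2 * π) : ℂ) * (∫ y : ℝ, Φ (((-(k : ℝ) - 1 / 2 : ℝ) : ℂ) + y * I) *
        ((w : ℂ) ^ (-((((-(k : ℝ) - 1 / 2 : ℝ) : ℂ) + y * I))) *
          Complex.Gamma (((-(k : ℝ) - 1 / 2 : ℝ) : ℂ) + y * I))) =
      ∑ j ∈ Finset.range (k + 1),
        (-1) ^ j * Φ (-(j : ℂ)) * (w : ℂ) ^ (j : ℕ) / (j.factorial : ℂ) := by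
    intro w hw k hk
    obtain ⟨C, hC⟩ := hfinC k
    have hK₁ : (1 : ℝ) ≤ k + M := by linarith [(k.cast_nonneg : (0:ℝ) ≤ k)]
    exact mellinBarnes_shift_eq_sum hΦ k hw (A₁ := C₀ * C₁ ^ k) (K₁ := k + M)
      (α := d * (k + 1) + E₀) (by positivity) hK₁ (by positivity) hA₂pos hB (hleftk k hk) hright hC
  ------------------------------------------------------------------
  -- (3) the remainder: `‖Lw w - S_k(w)‖ ≤ K'' x^{q_k}/q_k!`, which tends to `0`
  ------------------------------------------------------------------
  set cj : ℕ → ℂ := fun j ↦ (-1) ^ j * Φ (-(j : ℂ)) / (j.factorial : ℂ) with hcj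
  have hsumcj : ∀ (w : ℝ) (k : ℕ), ∑ j ∈ Finset.range (k + 1), cj j * (w : ℂ) ^ j =
      ∑ j ∈ Finset.range (k + 1),
        (-1) ^ j * Φ (-(j : ℂ)) * (w : ℂ) ^ (j : ℕ) / (j.factorial : ℂ) := by
    intro w k
    refine Finset.sum_congr rfl fun j _ ↦ ?_
    simp only [hcj]; ring
  obtain ⟨k₁, hk₁⟩ : ∃ k₁ : ℕ, k₀ + ⌈(2 + 2 * E₀) / (1 - d)⌉₊ = k₁ := ⟨_, rfl⟩
  obtain ⟨C₆, hC₆⟩ : ∃ C : ℝ, 2 * (2 / (1 - d) + M) = C := ⟨_, rfl⟩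
  have hC₆0 : 0 < C₆ := by rw [← hC₆]; positivity
  obtain ⟨I₀, hI₀⟩ : ∃ I₀ : ℝ, ∫ y : ℝ, Real.exp (-(π / 2 * |y|)) = I₀ := ⟨_, rfl⟩
  have hI₀0 : 0 ≤ I₀ := by rw [← hI₀]; exact integral_nonneg fun y ↦ (Real.exp_pos _).le
  have hrem : ∀ w : ℝ, 0 < w → ∀ k : ℕ, k₁ ≤ k →
      ‖Lw w - ∑ j ∈ Finset.range (k + 1), cj j * (w : ℂ) ^ j‖ ≤
        1 / (2 * π) * (C₀ * C₁ ^ k * Real.sqrt (2 * π) *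
          ((2 * C₆) ^ (k + 1) / (⌊(1 - d) * (k + 1) / 2⌋₊.factorial : ℝ)) *
          w ^ ((k : ℝ) + 1 / 2) * I₀) := by
    intro w hw k hk
    have hk0 : k₀ ≤ k := le_trans (by rw [← hk₁]; exact Nat.le_add_right _ _) hk
    have hkc : ⌈(2 + 2 * E₀) / (1 - d)⌉₊ ≤ k := le_trans (by rw [← hk₁]; exact Nat.le_add_left _ _) hk
    obtain ⟨hq1, -, hE⟩ := floor_conditions hd1 hd0 hE₀ hkc
    obtain ⟨hint, hid⟩ := hshift w hw k hk0
    have hE0 : 0 ≤ d * (k + 1) + E₀ := by positivity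
    have hR := norm_remainder_le (E₀ := E₀) hd1 hd0 hM hC₀ hC₁ rfl hq1 hE hE0 (hleftk k hk0) hw hint
    rw [hC₆, hI₀] at hR
    -- `Lw w - S_k = (1/2π) ∫_{σ_k}`
    have heq : Lw w - ∑ j ∈ Finset.range (k + 1), cj j * (w : ℂ) ^ j =
        (1 / (2 * π) : ℂ) * ∫ y : ℝ, Φ (((-(k : ℝ) - 1 / 2 : ℝ) : ℂ) + y * I) *
          ((w : ℂ) ^ (-((((-(k : ℝ) - 1 / 2 : ℝ) : ℂ) + y * I))) *
            Complex.Gamma (((-(k : ℝ) - 1 / 2 : ℝ) : ℂ) + y * I)) := by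
      rw [hsumcj, ← hid, hCM w hw]
      ring
    rw [heq, norm_mul]
    have hn : ‖(1 / (2 * π) : ℂ)‖ = 1 / (2 * π) := by
      rw [show (1 / (2 * π) : ℂ) = ((1 / (2 * π) : ℝ) : ℂ) by push_cast; ring]
      rw [Complex.norm_real, Real.norm_of_nonneg (by positivity)]
    rw [hn]
    exact mul_le_mul_of_nonneg_left hR (by positivity)
  -- the partial sums tend to `Lw w`
  have htend : ∀ w : ℝ, 0 < w →
      Tendsto (fun k : ℕ ↦ ∑ j ∈ Finset.range (k + 1), cj j * (w : ℂ) ^ j) atTop (𝓝 (Lw w)) := by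
    intro w hw
    obtain ⟨L, hL⟩ : ∃ L : ℕ, ⌈2 / (1 - d)⌉₊ = L := ⟨_, rfl⟩
    obtain ⟨A, hA⟩ : ∃ A : ℝ, max 1 (C₁ * (2 * C₆) * w) = A := ⟨_, rfl⟩
    have hA1 : 1 ≤ A := by rw [← hA]; exact le_max_left _ _
    have hAw : C₁ * (2 * C₆) * w ≤ A := by rw [← hA]; exact le_max_right _ _
    obtain ⟨x, hx⟩ : ∃ x : ℝ, A ^ L = x := ⟨_, rfl⟩
    have hx1 : 1 ≤ x := by rw [← hx]; exact one_le_pow₀ hA1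
    obtain ⟨K'', hK''⟩ : ∃ K : ℝ,
        1 / (2 * π) * (C₀ * Real.sqrt (2 * π) * w ^ (-(1 / 2 : ℝ)) * I₀) * x = K := ⟨_, rfl⟩
    have hK''0 : 0 ≤ K'' := by rw [← hK'']; positivity
    -- `q_k → ∞` and `x^q/q! → 0`
    have hq_tend : Tendsto (fun k : ℕ ↦ ⌊(1 - d) * (k + 1) / 2⌋₊) atTop atTop := by
      refine tendsto_nat_floor_atTop.comp ?_
      have h1 : Tendsto (fun k : ℕ ↦ ((k : ℝ) + 1)) atTop atTop :=
        tendsto_atTop_add_const_right _ 1 tendsto_natCast_atTop_atTop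
      have h2 := h1.const_mul_atTop (by positivity : 0 < (1 - d) / 2)
      refine h2.congr fun k ↦ ?_
      ring
    have hfac := ((Real.summable_pow_div_factorial x).tendsto_atTop_zero).comp hq_tend
    -- the bound of `hrem` is `≤ K'' x^{q_k}/q_k!`
    have hbound : ∀ k : ℕ, 1 / (2 * π) * (C₀ * C₁ ^ k * Real.sqrt (2 * π) *
        ((2 * C₆) ^ (k + 1) / (⌊(1 - d) * (k + 1) / 2⌋₊.factorial : ℝ)) *
          w ^ ((k : ℝ) + 1 / 2) * I₀) ≤
        K'' * (x ^ ⌊(1 - d) * (k + 1) / 2⌋₊ / (⌊(1 - d) * (k + 1) / 2⌋₊.factorial : ℝ)) := by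
      intro k
      obtain ⟨q, hq⟩ : ∃ q : ℕ, ⌊(1 - d) * (k + 1) / 2⌋₊ = q := ⟨_, rfl⟩
      rw [hq]
      have hkL : k + 1 ≤ L * (q + 1) := by
        have := succ_le_ceil_mul_floor_succ hd1 k; rwa [hL, hq] at this
      -- `C₁^k (2C₆)^{k+1} w^{k+1/2} ≤ w^{-1/2} A^{k+1} ≤ w^{-1/2} x^{q+1}`
      have h1 : C₁ ^ k * (2 * C₆) ^ (k + 1) * w ^ ((k : ℝ) + 1 / 2) ≤
          w ^ (-(1 / 2 : ℝ)) * A ^ (k + 1) := by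
        have e1 : w ^ ((k : ℝ) + 1 / 2) = w ^ (k + 1) * w ^ (-(1 / 2 : ℝ)) := by
          rw [← Real.rpow_natCast, ← Real.rpow_add hw]; congr 1; push_cast; ring
        have e2 : C₁ ^ k ≤ C₁ ^ (k + 1) := pow_le_pow_right₀ hC₁ (Nat.le_succ k)
        have e3 : C₁ ^ (k + 1) * (2 * C₆) ^ (k + 1) * w ^ (k + 1) = (C₁ * (2 * C₆) * w) ^ (k + 1) := by
          ring
        calc C₁ ^ k * (2 * C₆) ^ (k + 1) * w ^ ((k : ℝ) + 1 / 2)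
            ≤ C₁ ^ (k + 1) * (2 * C₆) ^ (k + 1) * (w ^ (k + 1) * w ^ (-(1 / 2 : ℝ))) := by
              rw [e1]; gcongr
          _ = w ^ (-(1 / 2 : ℝ)) * (C₁ ^ (k + 1) * (2 * C₆) ^ (k + 1) * w ^ (k + 1)) := by ring
          _ = w ^ (-(1 / 2 : ℝ)) * (C₁ * (2 * C₆) * w) ^ (k + 1) := by rw [e3]
          _ ≤ w ^ (-(1 / 2 : ℝ)) * A ^ (k + 1) :=
              mul_le_mul_of_nonneg_left (pow_le_pow_left₀ (by positivity) hAw _) (by positivity)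
      have h2 : A ^ (k + 1) ≤ x * x ^ q := by
        rw [← hx, ← pow_succ', ← pow_mul]
        exact pow_le_pow_right₀ hA1 (by rw [Nat.mul_comm] at hkL; linarith [hkL])
      have hqf : (0 : ℝ) < q.factorial := by positivity
      rw [← hK'', div_eq_mul_inv, div_eq_mul_inv]
      have hqi : 0 ≤ (q.factorial : ℝ)⁻¹ := by positivity
      calc 1 / (2 * π) * (C₀ * C₁ ^ k * Real.sqrt (2 * π) * ((2 * C₆) ^ (k + 1) * (q.factorial : ℝ)⁻¹) *
            w ^ ((k : ℝ) + 1 / 2) * I₀)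
          = 1 / (2 * π) * (C₀ * Real.sqrt (2 * π) * I₀) *
              (C₁ ^ k * (2 * C₆) ^ (k + 1) * w ^ ((k : ℝ) + 1 / 2)) * (q.factorial : ℝ)⁻¹ := by ring
        _ ≤ 1 / (2 * π) * (C₀ * Real.sqrt (2 * π) * I₀) *
              (w ^ (-(1 / 2 : ℝ)) * A ^ (k + 1)) * (q.factorial : ℝ)⁻¹ := by gcongr
        _ ≤ 1 / (2 * π) * (C₀ * Real.sqrt (2 * π) * I₀) *
              (w ^ (-(1 / 2 : ℝ)) * (x * x ^ q)) * (q.factorial : ℝ)⁻¹ := by gcongr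
        _ = 1 / (2 * π) * (C₀ * Real.sqrt (2 * π) * w ^ (-(1 / 2 : ℝ)) * I₀) * x *
              (x ^ q * (q.factorial : ℝ)⁻¹) := by ring
    rw [Metric.tendsto_atTop]
    intro ε hε
    have hfac' : Tendsto (fun k : ℕ ↦ K'' * (x ^ ⌊(1 - d) * (k + 1) / 2⌋₊ /
        (⌊(1 - d) * (k + 1) / 2⌋₊.factorial : ℝ))) atTop (𝓝 0) := by
      have := hfac.const_mul K''
      rw [mul_zero] at this
      exact this
    rw [Metric.tendsto_atTop] at hfac'
    obtain ⟨N₁, hN₁⟩ := hfac' ε hε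
    refine ⟨max N₁ k₁, fun k hk ↦ ?_⟩
    have hkk : k₁ ≤ k := le_of_max_le_right hk
    have hkN : N₁ ≤ k := le_of_max_le_left hk
    rw [dist_eq_norm, norm_sub_rev]
    have h1 := hrem w hw k hkk
    have h2 := hN₁ k hkN
    rw [dist_zero_right, Real.norm_of_nonneg (by positivity)] at h2
    exact lt_of_le_of_lt (h1.trans (hbound k)) h2
  ------------------------------------------------------------------
  -- (4) the power series `Et z = ∑ c_j z^j` has infinite radius; `Et` entire, `Et = Lw` on `w > 0`
  ------------------------------------------------------------------
  have hterm0 : ∀ w : ℝ, 0 < w → Tendsto (fun j : ℕ ↦ cj j * (w : ℂ) ^ j) atTop (𝓝 0) := by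
    intro w hw
    have h := htend w hw
    have h2 := (h.comp (tendsto_add_atTop_nat 1)).sub h
    rw [sub_self] at h2
    have h3 : Tendsto (fun k : ℕ ↦ cj (k + 1) * (w : ℂ) ^ (k + 1)) atTop (𝓝 0) := by
      refine h2.congr fun k ↦ ?_
      simp only [Function.comp_apply]
      rw [Finset.sum_range_succ _ (k + 1)]
      ring
    exact (tendsto_add_atTop_iff_nat 1).1 h3
  have hsumm : ∀ r : ℝ, 0 ≤ r → Summable fun j : ℕ ↦ ‖cj j‖ * r ^ j := by
    intro r hr
    have hw : (0 : ℝ) < 2 * r + 1 := by positivity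
    have hev : ∀ᶠ j : ℕ in atTop, ‖cj j * ((2 * r + 1 : ℝ) : ℂ) ^ j‖ ≤ 1 := by
      have h0 := (hterm0 (2 * r + 1) hw).norm
      rw [norm_zero] at h0
      exact h0.eventually (ge_mem_nhds (by norm_num))
    refine Summable.of_norm_bounded_eventually (g := fun j ↦ (1 / 2 : ℝ) ^ j)
      (summable_geometric_of_lt_one (by norm_num) (by norm_num)) ?_
    rw [Nat.cofinite_eq_atTop]
    filter_upwards [hev] with j hj
    rw [Real.norm_of_nonneg (by positivity)]
    have hrw : r / (2 * r + 1) ≤ 1 / 2 := by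
      rw [div_le_iff₀ hw]; linarith
    have hrw0 : 0 ≤ r / (2 * r + 1) := by positivity
    have hn : ‖cj j * ((2 * r + 1 : ℝ) : ℂ) ^ j‖ = ‖cj j‖ * (2 * r + 1) ^ j := by
      rw [norm_mul, norm_pow, Complex.norm_real, Real.norm_of_nonneg hw.le]
    rw [hn] at hj
    calc ‖cj j‖ * r ^ j = ‖cj j‖ * (2 * r + 1) ^ j * (r / (2 * r + 1)) ^ j := by
          rw [div_pow]; field_simp
      _ ≤ 1 * (1 / 2) ^ j :=
          mul_le_mul hj (pow_le_pow_left₀ hrw0 hrw j) (by positivity) zero_le_one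
      _ = (1 / 2) ^ j := one_mul _
  set Et : ℂ → ℂ := fun z ↦ ∑' j : ℕ, cj j * z ^ j with hEt
  have hEtdiff : Differentiable ℂ Et := by
    intro z
    have hR : 0 < ‖z‖ + 1 := by positivity
    have hdiffon : DifferentiableOn ℂ Et (Metric.ball 0 (‖z‖ + 1)) := by
      refine differentiableOn_tsum_of_summable_norm (u := fun j ↦ ‖cj j‖ * (‖z‖ + 1) ^ j)
        (hsumm _ hR.le) (fun j ↦ ((differentiable_const _).mul (differentiable_id.pow j)).differentiableOn)
        Metric.isOpen_ball fun j y hy ↦ ?_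
      rw [norm_mul, norm_pow]
      have : ‖y‖ ≤ ‖z‖ + 1 := by
        rw [Metric.mem_ball, dist_zero_right] at hy; exact hy.le
      gcongr
    have hz : z ∈ Metric.ball (0 : ℂ) (‖z‖ + 1) := by
      rw [Metric.mem_ball, dist_zero_right]; linarith
    exact hdiffon.differentiableAt (Metric.isOpen_ball.mem_nhds hz)
  have hEtLw : ∀ w : ℝ, 0 < w → Et (w : ℂ) = Lw w := by
    intro w hw
    have hs : Summable fun j ↦ cj j * (w : ℂ) ^ j := by
      refine Summable.of_norm ?_
      have := hsumm w hw.le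
      refine this.congr fun j ↦ ?_
      rw [norm_mul, norm_pow, Complex.norm_real, Real.norm_of_nonneg hw.le]
    have h1 := hs.hasSum.tendsto_sum_nat.comp (tendsto_add_atTop_nat 1)
    exact tendsto_nhds_unique h1 (htend w hw)
  ------------------------------------------------------------------
  -- (5) the exponential series `Lc z = ∑ b(n) e^{-nz}` on the right half-plane
  ------------------------------------------------------------------
  set Lc : ℂ → ℂ := fun z ↦ ∑' n : ℕ, b' n * Complex.exp (-(n * z)) with hLc
  obtain ⟨Cb, hCb⟩ := hb.le_const_mul_rpow
  have hCb' : ∀ n : ℕ, ‖b' n‖ ≤ |Cb| * (n : ℝ) ^ 2 := by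
    intro n
    rcases eq_or_ne n 0 with rfl | hn
    · simp [hb']
    · rw [hb'n hn]
      have h := hCb n hn
      have hre : (((3 / 2 : ℝ) : ℂ)).re = 3 / 2 := Complex.ofReal_re _
      rw [hre] at h
      have hn1 : (1 : ℝ) ≤ n := by exact_mod_cast Nat.one_le_iff_ne_zero.2 hn
      have hp : (n : ℝ) ^ (3 / 2 : ℝ) ≤ (n : ℝ) ^ 2 := by
        rw [← Real.rpow_two]
        exact Real.rpow_le_rpow_of_exponent_le hn1 (by norm_num)
      calc ‖b n‖ ≤ Cb * (n : ℝ) ^ (3 / 2 : ℝ) := h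
        _ ≤ |Cb| * (n : ℝ) ^ (3 / 2 : ℝ) :=
            mul_le_mul_of_nonneg_right (le_abs_self _) (by positivity)
        _ ≤ |Cb| * (n : ℝ) ^ 2 := mul_le_mul_of_nonneg_left hp (abs_nonneg _)
  have hsumδ : ∀ δ : ℝ, 0 < δ → Summable fun n : ℕ ↦ ‖b' n‖ * Real.exp (-(n * δ)) := by
    intro δ hδ
    have h := (Real.summable_pow_mul_exp_neg_nat_mul 2 hδ).mul_left |Cb|
    refine .of_nonneg_of_le (fun n ↦ by positivity) (fun n ↦ ?_) h
    calc ‖b' n‖ * Real.exp (-(n * δ)) ≤ |Cb| * (n : ℝ) ^ 2 * Real.exp (-(n * δ)) := by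
          gcongr; exact hCb' n
      _ = |Cb| * ((n : ℝ) ^ 2 * Real.exp (-δ * n)) := by
          rw [show -((n : ℝ) * δ) = -δ * n by ring]; ring
  have hLcdiff : DifferentiableOn ℂ Lc {z : ℂ | 0 < z.re} := by
    intro z hz
    have hz' : 0 < z.re := hz
    have hδ : 0 < z.re / 2 := by positivity
    have hopen : IsOpen {y : ℂ | z.re / 2 < y.re} := isOpen_lt continuous_const Complex.continuous_re
    have hdiff : DifferentiableOn ℂ Lc {y : ℂ | z.re / 2 < y.re} := by
      refine differentiableOn_tsum_of_summable_norm (u := fun n ↦ ‖b' n‖ * Real.exp (-(n * (z.re / 2))))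
        (hsumδ _ hδ) (fun n ↦ ?_) hopen fun n y hy ↦ ?_
      · exact (by fun_prop : Differentiable ℂ fun y : ℂ ↦ b' n * Complex.exp (-(n * y))).differentiableOn
      · have hy' : z.re / 2 < y.re := hy
        rw [norm_mul, Complex.norm_exp]
        have : (-((n : ℂ) * y)).re = -(n * y.re) := by simp
        rw [this]
        refine mul_le_mul_of_nonneg_left (Real.exp_le_exp.2 ?_) (norm_nonneg _)
        have : (0 : ℝ) ≤ n := n.cast_nonneg
        nlinarith
    have hmem : {y : ℂ | z.re / 2 < y.re} ∈ 𝓝 z := hopen.mem_nhds (by show z.re / 2 < z.re; linarith)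
    exact (hdiff.differentiableAt hmem).differentiableWithinAt
  have hLcLw : ∀ w : ℝ, 0 < w → Lc (w : ℂ) = Lw w := by
    intro w hw
    simp only [hLc, hLw]
    refine tsum_congr fun n ↦ ?_
    rw [hb'term]
    push_cast
    rfl
  have hLcper : ∀ z : ℂ, Lc (z + 2 * π * I) = Lc z := by
    intro z
    simp only [hLc]
    refine tsum_congr fun n ↦ ?_
    congr 1
    rw [mul_add, neg_add, Complex.exp_add]
    have : Complex.exp (-((n : ℂ) * (2 * π * I))) = 1 := by
      rw [Complex.exp_neg, Complex.exp_nat_mul_two_pi_mul_I, inv_one]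
    rw [this, mul_one]
  ------------------------------------------------------------------
  -- (6) `Et = Lc` on the right half-plane (identity theorem)
  ------------------------------------------------------------------
  have hU : IsOpen {z : ℂ | 0 < z.re} := isOpen_lt continuous_const Complex.continuous_re
  have hEq : EqOn Et Lc {z : ℂ | 0 < z.re} := by
    refine AnalyticOnNhd.eqOn_of_preconnected_of_mem_closure
      (hEtdiff.differentiableOn.analyticOnNhd hU) (hLcdiff.analyticOnNhd hU)
      (convex_halfSpace_re_gt 0).isPreconnected (z₀ := 1) (by simp) ?_
    refine mem_closure_of_tendsto (f := fun n : ℕ ↦ (((1 + 1 / ((n : ℝ) + 1) : ℝ)) : ℂ))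
      (b := atTop) ?_ (Eventually.of_forall fun n ↦ ?_)
    · have h1 : Tendsto (fun n : ℕ ↦ (1 + 1 / ((n : ℝ) + 1) : ℝ)) atTop (𝓝 1) := by
        have := tendsto_one_div_add_atTop_nhds_zero_nat (𝕜 := ℝ)
        simpa using (tendsto_const_nhds (x := (1 : ℝ))).add this
      have h2 := (Complex.continuous_ofReal.tendsto 1).comp h1
      rw [Complex.ofReal_one] at h2
      exact h2
    · have hpos : 0 < 1 + 1 / ((n : ℝ) + 1) := by positivity
      refine ⟨?_, ?_⟩
      · show Et _ = Lc _
        rw [hEtLw _ hpos, hLcLw _ hpos]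
      · simp only [Set.mem_singleton_iff]
        intro h
        have h1 := congrArg Complex.re h
        simp only [Complex.ofReal_re, Complex.one_re] at h1
        have : 0 < 1 / ((n : ℝ) + 1) := by positivity
        linarith
  ------------------------------------------------------------------
  -- (7) `Et` is `2πi`-periodic (identity theorem again)
  ------------------------------------------------------------------
  have hEtper : ∀ z : ℂ, Et (z + 2 * π * I) = Et z := by
    have hA1 : AnalyticOnNhd ℂ (fun z ↦ Et (z + 2 * π * I)) univ :=
      Complex.analyticOnNhd_univ_iff_differentiable.mpr (hEtdiff.comp (differentiable_id.add_const _))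
    have hA2 : AnalyticOnNhd ℂ Et univ := Complex.analyticOnNhd_univ_iff_differentiable.mpr hEtdiff
    have hev : (fun z ↦ Et (z + 2 * π * I)) =ᶠ[𝓝 (1 : ℂ)] Et := by
      filter_upwards [hU.mem_nhds (show (1 : ℂ) ∈ {z : ℂ | 0 < z.re} by simp)] with z hz
      have hz' : 0 < z.re := hz
      have hz2 : z + 2 * π * I ∈ {z : ℂ | 0 < z.re} := by
        show 0 < (z + 2 * π * I).re; simpa using hz'
      rw [hEq hz2, hLcper, ← hEq hz]
    intro z
    exact hA1.eqOn_of_preconnected_of_eventuallyEq hA2 isPreconnected_univ (mem_univ 1) hev (mem_univ z)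
  ------------------------------------------------------------------
  -- (8) the decay of the coefficients
  ------------------------------------------------------------------
  have hsum1 : Summable fun m : ℕ ↦ ‖b' m‖ * Real.exp (-(m * (1 : ℝ))) := hsumδ 1 one_pos
  have hrep : ∀ y : ℝ, Et (((1 : ℝ) : ℂ) + y * I) =
      ∑' m : ℕ, b' m * Complex.exp (-(m * (((1 : ℝ) : ℂ) + y * I))) := by
    intro y
    have hmem : ((1 : ℝ) : ℂ) + y * I ∈ {z : ℂ | 0 < z.re} := by
      show 0 < (((1 : ℝ) : ℂ) + y * I).re; simp
    rw [hEq hmem]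
  obtain ⟨Mx, hMx⟩ := norm_coeff_le_of_periodic_entire hEtdiff hEtper hsum1 hrep X
  exact ⟨Mx, fun n hn ↦ by rw [← hb'n hn]; exact hMx n⟩

end Literature.Analysis.Complex
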